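import Summits.NavierStokesRegularity.NavierStokesRegularity.Theorems.TargetDepletionLadderBoundedMollified
import Summits.NavierStokesRegularity.NavierStokesRegularity.Theorems.TargetDepletionLadderBoundedLFour
import Literature.Analysis.FluidPDE.EulerSymmetricGradient
import Literature.Analysis.FunctionSpaces.MollificationLp
import HarnessLib

/-!
# Crux `Target` (stmt-NavierStokesRegularity-1217), line `depletion_ladder`, stub S1 (registered class):
# the stretching integral is continuous under mollification

`--supports stmt-NavierStokesRegularity-1217` (seat leafhand-ns-poloidalwindowdoor-3 g0, cell decomp-ns; the
last analytic step of the registered-class programme for `stub_depletionBelowHalf`).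

For `u` in the registered binders of `StretchingDepletion` (`u ∈ C²`, `div u = 0`, `‖u‖ ≤ M`,
`‖curl u‖² ∈ L¹`, `|∇ curl u|²_F ∈ L¹`, `⟪ω, Du ω⟫ ∈ L¹`) and bump kernels `φₙ` with `rOut(φₙ) → 0`,
with `uₙ = φₙ.normed ⋆ u`, `ωₙ = curl uₙ = φₙ.normed ⋆ ω`, `Duₙ = φₙ.normed ⋆ Du`:

* `tendsto_integral_stretching_mollify` — **`∫⟪ωₙ, Duₙ ωₙ⟫ → ∫⟪ω, Du ω⟫`.** Pointwise
  `|⟪ωₙ, Duₙωₙ⟫ − ⟪ω, Duω⟫| ≤ ‖ωₙ − ω‖‖Duₙ‖‖ωₙ‖ + ‖Duₙ − Du‖‖ω‖‖ωₙ‖ + ‖ωₙ − ω‖‖ω‖‖Du‖`; Cauchy–Schwarz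
  puts each term below `√(L² error) · √(∫ of a product of two L⁴ factors)`, the `L⁴` factors being
  uniformly bounded by Jensen (`memLp_four_convolution`; `‖ω‖⁴, ‖Du‖⁴ ∈ L¹` by `…BoundedLFour`), and the
  `L²` errors tend to zero (`tendsto_eLpNorm_normed_convolution_sub_self` for `ω`,
  `HasWeakGradient.tendsto_lintegral_frobenius_fderiv_convolution_sub` for `Du`).
* `abs_integral_stretching_le_sharp_of_registered` — ★ consequently, by
  `BoundedMollified.abs_integral_stretching_mollify_le` along `φₙ` (`exists_contDiffBump_seq`):
  **`|∫⟪ω, Du ω⟫| ≤ ((2+√3)/9) · M · √(∫‖ω‖²) · √(∫|∇ω|²_F)` for EVERY field of the registered class**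
  — the depletion inequality with `κ = (2+√3)/9 < 1/2`, no decay, no smoothness beyond `C²`, no
  gradient bound.

HONEST LABEL: helper (S1 is closed by name in `TargetDepletionLadderStubDepletionBelowHalfByName.lean`);
no Navier–Stokes content; `Target` = S3 and NS regularity remain OPEN. [folklore]
-/

noncomputable section

-- the summit and its single sub-problem share the name (CONVENTIONS §1)
set_option linter.dupNamespace false

open Set Filter Topology MeasureTheory ContinuousLinearMap
open scoped RealInnerProductSpace ENNReal NNReal Convolution ContDiff
open Literature.Analysis.FluidPDE Literature.Analysis.FunctionSpaces

namespace Summit.NavierStokesRegularity.NavierStokesRegularity.Theorems.DepletionLadder.BoundedStretchingLimit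

open Summit.NavierStokesRegularity.NavierStokesRegularity.Theorems.DepletionLadder.BoundedDivCurl
open Summit.NavierStokesRegularity.NavierStokesRegularity.Theorems.DepletionLadder.BoundedSobolevData
open Summit.NavierStokesRegularity.NavierStokesRegularity.Theorems.DepletionLadder.BoundedSharpDepletion
open Summit.NavierStokesRegularity.NavierStokesRegularity.Theorems.DepletionLadder.BoundedMollified
open Summit.NavierStokesRegularity.NavierStokesRegularity.Theorems.DepletionLadder.BoundedLFour

variable {u : EuclideanSpace ℝ (Fin 3) → EuclideanSpace ℝ (Fin 3)}

/-- `∫ ‖f‖² = (∫⁻ ‖f‖ₑ²).toReal` for `‖f‖² ∈ L¹`. [folklore] -/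
theorem integral_sq_norm_eq_toReal {F : Type*} [NormedAddCommGroup F]
    {f : EuclideanSpace ℝ (Fin 3) → F} (hf : Integrable fun x => ‖f x‖ ^ 2) :
    ∫ x, ‖f x‖ ^ 2 = (∫⁻ x, ‖f x‖ₑ ^ 2).toReal := by
  rw [integral_eq_lintegral_of_nonneg_ae (ae_of_all _ fun x => sq_nonneg _) hf.aestronglyMeasurable]
  congr 1
  refine lintegral_congr fun x => ?_
  rw [← ofReal_norm, ENNReal.ofReal_pow (norm_nonneg _)]

/-- `|A − B|²_F ≤ 2|A|²_F + 2|B|²_F`. [folklore] -/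
theorem frobeniusNormSq_sub_le (A B : EuclideanSpace ℝ (Fin 3) →L[ℝ] EuclideanSpace ℝ (Fin 3)) :
    frobeniusNormSq (A - B) ≤ 2 * frobeniusNormSq A + 2 * frobeniusNormSq B := by
  unfold frobeniusNormSq
  rw [Finset.mul_sum, Finset.mul_sum, ← Finset.sum_add_distrib]
  refine Finset.sum_le_sum fun i _ => ?_
  rw [_root_.sub_apply]
  have h := norm_sub_le (A (stdOrthonormalBasis ℝ (EuclideanSpace ℝ (Fin 3)) i))
    (B (stdOrthonormalBasis ℝ (EuclideanSpace ℝ (Fin 3)) i))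
  have h2 : ‖A (stdOrthonormalBasis ℝ (EuclideanSpace ℝ (Fin 3)) i) -
      B (stdOrthonormalBasis ℝ (EuclideanSpace ℝ (Fin 3)) i)‖ ^ 2 ≤
      (‖A (stdOrthonormalBasis ℝ (EuclideanSpace ℝ (Fin 3)) i)‖ +
        ‖B (stdOrthonormalBasis ℝ (EuclideanSpace ℝ (Fin 3)) i)‖) ^ 2 :=
    pow_le_pow_left₀ (norm_nonneg _) h 2
  nlinarith [sq_nonneg (‖A (stdOrthonormalBasis ℝ (EuclideanSpace ℝ (Fin 3)) i)‖ -
    ‖B (stdOrthonormalBasis ℝ (EuclideanSpace ℝ (Fin 3)) i)‖)]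

/-- `MemLp f 4` from `‖f‖⁴ ∈ L¹` for a continuous `f`. [folklore] -/
theorem memLp_four_of_integrable {F : Type*} [NormedAddCommGroup F] [NormedSpace ℝ F]
    {f : EuclideanSpace ℝ (Fin 3) → F} (hf : Continuous f) (h4 : Integrable fun x => ‖f x‖ ^ 4) :
    MemLp f 4 volume := by
  refine (integrable_norm_rpow_iff hf.aestronglyMeasurable (by norm_num) (by norm_num)).1 ?_
  refine h4.congr (ae_of_all _ fun x => ?_)
  simp only [ENNReal.toReal_ofNat]
  rw [show (4 : ℝ) = ((4 : ℕ) : ℝ) by norm_num, Real.rpow_natCast]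

/-- The pointwise trilinear estimate: for vectors `a, a'` and operators `B, B'`,
`|⟪a', B' a'⟫ − ⟪a, B a⟫| ≤ ‖a' − a‖(‖B'‖‖a'‖) + ‖B' − B‖(‖a‖‖a'‖) + ‖a' − a‖(‖a‖‖B‖)`. [folklore] -/
theorem abs_inner_apply_sub_le (a a' : EuclideanSpace ℝ (Fin 3))
    (B B' : EuclideanSpace ℝ (Fin 3) →L[ℝ] EuclideanSpace ℝ (Fin 3)) :
    |⟪a', B' a'⟫ - ⟪a, B a⟫| ≤
      ‖a' - a‖ * (‖B'‖ * ‖a'‖) + ‖B' - B‖ * (‖a‖ * ‖a'‖) + ‖a' - a‖ * (‖a‖ * ‖B‖) := by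
  have hsplit : ⟪a', B' a'⟫ - ⟪a, B a⟫ =
      ⟪a' - a, B' a'⟫ + ⟪a, (B' - B) a'⟫ + ⟪a, B (a' - a)⟫ := by
    simp only [inner_sub_left, inner_sub_right, map_sub, _root_.sub_apply]
    ring
  rw [hsplit]
  have h1 : |⟪a' - a, B' a'⟫| ≤ ‖a' - a‖ * (‖B'‖ * ‖a'‖) :=
    (abs_real_inner_le_norm _ _).trans (mul_le_mul_of_nonneg_left (B'.le_opNorm a') (norm_nonneg _))
  have h2 : |⟪a, (B' - B) a'⟫| ≤ ‖B' - B‖ * (‖a‖ * ‖a'‖) := by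
    calc |⟪a, (B' - B) a'⟫| ≤ ‖a‖ * ‖(B' - B) a'‖ := abs_real_inner_le_norm _ _
      _ ≤ ‖a‖ * (‖B' - B‖ * ‖a'‖) := mul_le_mul_of_nonneg_left ((B' - B).le_opNorm a') (norm_nonneg _)
      _ = ‖B' - B‖ * (‖a‖ * ‖a'‖) := by ring
  have h3 : |⟪a, B (a' - a)⟫| ≤ ‖a' - a‖ * (‖a‖ * ‖B‖) := by
    calc |⟪a, B (a' - a)⟫| ≤ ‖a‖ * ‖B (a' - a)‖ := abs_real_inner_le_norm _ _
      _ ≤ ‖a‖ * (‖B‖ * ‖a' - a‖) := mul_le_mul_of_nonneg_left (B.le_opNorm _) (norm_nonneg _)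
      _ = ‖a' - a‖ * (‖a‖ * ‖B‖) := by ring
  calc |⟪a' - a, B' a'⟫ + ⟪a, (B' - B) a'⟫ + ⟪a, B (a' - a)⟫|
      ≤ |⟪a' - a, B' a'⟫ + ⟪a, (B' - B) a'⟫| + |⟪a, B (a' - a)⟫| := abs_add_le _ _
    _ ≤ |⟪a' - a, B' a'⟫| + |⟪a, (B' - B) a'⟫| + |⟪a, B (a' - a)⟫| :=
        add_le_add (abs_add_le _ _) le_rfl
    _ ≤ _ := by linarith

/-- Products of two `L⁴` factors are in `L²`: for continuous `f, g` with `‖f‖⁴, ‖g‖⁴ ∈ L¹`,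
`(‖f‖‖g‖)² ∈ L¹` and `∫ (‖f‖‖g‖)² ≤ (∫‖f‖⁴ + ∫‖g‖⁴)/2`. [folklore] -/
theorem integrable_sq_norm_mul_norm {F₁ F₂ : Type*} [NormedAddCommGroup F₁] [NormedAddCommGroup F₂]
    {f : EuclideanSpace ℝ (Fin 3) → F₁} {g : EuclideanSpace ℝ (Fin 3) → F₂}
    (hf : Continuous f) (hg : Continuous g)
    (hf4 : Integrable fun x => ‖f x‖ ^ 4) (hg4 : Integrable fun x => ‖g x‖ ^ 4) :
    Integrable (fun x => (‖f x‖ * ‖g x‖) ^ 2) ∧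
      ∫ x, (‖f x‖ * ‖g x‖) ^ 2 ≤ ((∫ x, ‖f x‖ ^ 4) + ∫ x, ‖g x‖ ^ 4) / 2 := by
  have hmaj : Integrable fun x => (‖f x‖ ^ 4 + ‖g x‖ ^ 4) / 2 := (hf4.add hg4).div_const 2
  have hpt : ∀ x, (‖f x‖ * ‖g x‖) ^ 2 ≤ (‖f x‖ ^ 4 + ‖g x‖ ^ 4) / 2 := fun x => by
    nlinarith [sq_nonneg (‖f x‖ ^ 2 - ‖g x‖ ^ 2)]
  have hi : Integrable fun x => (‖f x‖ * ‖g x‖) ^ 2 := by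
    refine hmaj.mono' ((hf.norm.mul hg.norm).pow 2).aestronglyMeasurable (ae_of_all _ fun x => ?_)
    rw [Real.norm_of_nonneg (sq_nonneg _)]
    exact hpt x
  refine ⟨hi, ?_⟩
  calc ∫ x, (‖f x‖ * ‖g x‖) ^ 2 ≤ ∫ x, (‖f x‖ ^ 4 + ‖g x‖ ^ 4) / 2 := integral_mono hi hmaj hpt
    _ = ((∫ x, ‖f x‖ ^ 4) + ∫ x, ‖g x‖ ^ 4) / 2 := by
        rw [integral_div, integral_add hf4 hg4]

/-- Continuity of `x ↦ |L(x)|²_F` for a continuous operator field `L`. [folklore] -/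
theorem continuous_frobeniusNormSq_comp
    {L : EuclideanSpace ℝ (Fin 3) → EuclideanSpace ℝ (Fin 3) →L[ℝ] EuclideanSpace ℝ (Fin 3)}
    (hL : Continuous L) : Continuous fun x => frobeniusNormSq (L x) := by
  unfold frobeniusNormSq
  exact continuous_finsetSum _ fun i _ => ((hL.clm_apply continuous_const).norm).pow 2

/-! ### The convergence theorem -/

set_option maxHeartbeats 400000 in
/-- **The stretching integral is continuous under mollification.** For `u` in the registered binders
of `StretchingDepletion` and bump kernels `φₙ` with `rOut(φₙ) → 0`:
`∫⟪curl uₙ, Duₙ (curl uₙ)⟫ → ∫⟪curl u, Du (curl u)⟫`, `uₙ = φₙ.normed ⋆ u`. [folklore] -/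
theorem tendsto_integral_stretching_mollify (hu : ContDiff ℝ 2 u) (hdiv : VectorCalculus.IsDivFree u)
    {M : ℝ} (hM : ∀ x, ‖u x‖ ≤ M) (hZ : Integrable fun x => ‖curl u x‖ ^ 2)
    (hP : Integrable fun x => frobeniusNormSq (fderiv ℝ (curl u) x))
    (hJ : Integrable fun x => ⟪curl u x, fderiv ℝ u x (curl u x)⟫)
    {φ : ℕ → ContDiffBump (0 : EuclideanSpace ℝ (Fin 3))}
    (hφ : Tendsto (fun n => (φ n).rOut) atTop (𝓝 0)) :
    Tendsto (fun n => ∫ x, ⟪curl ((φ n).normed volume ⋆[lsmul ℝ ℝ, volume] u) x,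
        fderiv ℝ ((φ n).normed volume ⋆[lsmul ℝ ℝ, volume] u) x
          (curl ((φ n).normed volume ⋆[lsmul ℝ ℝ, volume] u) x)⟫) atTop
      (𝓝 (∫ x, ⟪curl u x, fderiv ℝ u x (curl u x)⟫)) := by
  have hu1 : ContDiff ℝ 1 u := hu.of_le (by norm_num)
  set om : EuclideanSpace ℝ (Fin 3) → EuclideanSpace ℝ (Fin 3) := curl u with homdef
  set T : EuclideanSpace ℝ (Fin 3) → EuclideanSpace ℝ (Fin 3) →L[ℝ] EuclideanSpace ℝ (Fin 3) :=
    fderiv ℝ u with hTdef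
  set U : ℕ → EuclideanSpace ℝ (Fin 3) → EuclideanSpace ℝ (Fin 3) := fun n =>
    (φ n).normed volume ⋆[lsmul ℝ ℝ, volume] u with hUdef
  have homc : Continuous om := continuous_curl hu1
  have hTc : Continuous T := hu1.continuous_fderiv one_ne_zero
  have hom2 : MemLp om 2 volume := (memLp_two_iff_integrable_sq_norm homc.aestronglyMeasurable).2 hZ
  have hG : HasWeakGradient u T := hasWeakGradient_fderiv_of_contDiff hu1
  -- the mollified vorticity and gradient
  have homn : ∀ n, curl (U n) = (φ n).normed volume ⋆[lsmul ℝ ℝ, volume] om := fun n =>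
    curl_mollify (φ n) hu1
  have hTn : ∀ n, fderiv ℝ (U n) = (φ n).normed volume ⋆[lsmul ℝ ℝ, volume] T := fun n =>
    funext fun x => HasWeakGradient.fderiv_normed_convolution hG (φ n) x
  have hUs : ∀ n, ContDiff ℝ ∞ (U n) := fun n => contDiff_mollify (φ n) hu.continuous
  have hU1 : ∀ n, ContDiff ℝ 1 (U n) := fun n => (hUs n).of_le (by norm_cast)
  have homnc : ∀ n, Continuous (curl (U n)) := fun n => continuous_curl (hU1 n)
  have hTnc : ∀ n, Continuous (fderiv ℝ (U n)) := fun n => (hU1 n).continuous_fderiv one_ne_zero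
  -- `L⁴` data and the uniform Jensen bounds
  obtain ⟨hom4, -⟩ := integrable_norm_curl_pow_four hu hZ hP
  have hT4 : Integrable fun x => ‖T x‖ ^ 4 := integrable_norm_fderiv_pow_four hu hdiv hM hZ hP
  have homm4 : MemLp om 4 volume := memLp_four_of_integrable homc hom4
  have hTm4 : MemLp T 4 volume := memLp_four_of_integrable hTc hT4
  have homn4 : ∀ n, Integrable (fun x => ‖curl (U n) x‖ ^ 4) ∧
      ∫ x, ‖curl (U n) x‖ ^ 4 ≤ ∫ x, ‖om x‖ ^ 4 := by
    intro n
    obtain ⟨hm, hle⟩ := memLp_four_convolution (φ n).continuous_normed (φ n).hasCompactSupport_normed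
      (φ n).nonneg_normed (φ n).integral_normed homm4
    rw [homn n]
    have hm' : MemLp ((φ n).normed volume ⋆[lsmul ℝ ℝ, volume] om) ((4 : ℕ) : ℝ≥0∞) volume := by
      simpa using hm
    exact ⟨hm'.integrable_norm_pow (by norm_num), hle⟩
  have hTn4 : ∀ n, Integrable (fun x => ‖fderiv ℝ (U n) x‖ ^ 4) ∧
      ∫ x, ‖fderiv ℝ (U n) x‖ ^ 4 ≤ ∫ x, ‖T x‖ ^ 4 := by
    intro n
    obtain ⟨hm, hle⟩ := memLp_four_convolution (φ n).continuous_normed (φ n).hasCompactSupport_normed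
      (φ n).nonneg_normed (φ n).integral_normed hTm4
    rw [hTn n]
    have hm' : MemLp ((φ n).normed volume ⋆[lsmul ℝ ℝ, volume] T) ((4 : ℕ) : ℝ≥0∞) volume := by
      simpa using hm
    exact ⟨hm'.integrable_norm_pow (by norm_num), hle⟩
  set W4 : ℝ := ∫ x, ‖om x‖ ^ 4 with hW4
  set T4 : ℝ := ∫ x, ‖T x‖ ^ 4 with hT4def
  set K : ℝ := Real.sqrt ((T4 + W4) / 2) + Real.sqrt ((W4 + W4) / 2) + Real.sqrt ((W4 + T4) / 2)
    with hK
  have hK0 : 0 ≤ K := by positivity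
  -- the `L²` errors
  set a : ℕ → ℝ := fun n => ∫ x, ‖curl (U n) x - om x‖ ^ 2 with ha
  set b : ℕ → ℝ := fun n => ∫ x, frobeniusNormSq (fderiv ℝ (U n) x - T x) with hb
  -- (1) `a n → 0`
  have haint : ∀ n, Integrable fun x => ‖curl (U n) x - om x‖ ^ 2 := by
    intro n
    rw [homn n]
    obtain ⟨hm, -⟩ := memLp_two_convolution (φ n).continuous_normed (φ n).hasCompactSupport_normed
      (φ n).nonneg_normed (φ n).integral_normed hom2
    exact (memLp_two_iff_integrable_sq_norm (hm.sub hom2).1).1 (hm.sub hom2)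
  have ha0 : Tendsto a atTop (𝓝 0) := by
    have h1 := tendsto_eLpNorm_normed_convolution_sub_self (μ := (volume : Measure
      (EuclideanSpace ℝ (Fin 3)))) hφ (p := 2) one_le_two (by norm_num) hom2
    have h2 : Tendsto (fun n => eLpNorm ((φ n).normed volume ⋆[lsmul ℝ ℝ, volume] om - om) 2 volume ^ 2)
        atTop (𝓝 0) := by
      have := (ENNReal.continuous_pow 2).tendsto (0 : ℝ≥0∞) |>.comp h1
      simpa [Function.comp_def] using this
    have h3 : Tendsto (fun n => (∫⁻ x, ‖((φ n).normed volume ⋆[lsmul ℝ ℝ, volume] om - om) x‖ₑ ^ 2).toReal)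
        atTop (𝓝 0) := by
      have := (ENNReal.tendsto_toReal ENNReal.zero_ne_top).comp h2
      simp only [ENNReal.toReal_zero] at this
      refine this.congr fun n => ?_
      simp only [Function.comp_apply]
      rw [MollifiedLimits.eLpNorm_two_pow_two]
    refine h3.congr fun n => ?_
    rw [ha]
    show _ = ∫ x, ‖curl (U n) x - om x‖ ^ 2
    rw [integral_sq_norm_eq_toReal (haint n), homn n]
    rfl
  -- (2) `b n → 0`
  have hD : Integrable fun x => frobeniusNormSq (fderiv ℝ u x) :=
    integrable_frobeniusNormSq_fderiv_of_bounded hu hdiv hM hZ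
  have hP0 : ∀ x, 0 ≤ frobeniusNormSq (fderiv ℝ u x) := fun x => frobeniusNormSq_nonneg _
  have hG2 : ∫⁻ x, ENNReal.ofReal (frobeniusNormSq (T x)) < ⊤ := by
    rw [← ofReal_integral_eq_lintegral_ofReal hD (ae_of_all _ hP0)]
    exact ENNReal.ofReal_lt_top
  have hbint : ∀ n, Integrable fun x => frobeniusNormSq (fderiv ℝ (U n) x - T x) := by
    intro n
    obtain ⟨hZn, -⟩ := integrable_norm_curl_mollify_sq (φ n) hu1 hZ
    have hDn : Integrable fun x => frobeniusNormSq (fderiv ℝ (U n) x) :=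
      integrable_frobeniusNormSq_fderiv_of_bounded ((hUs n).of_le (by norm_cast))
        (isDivFree_mollify (φ n) hu1 hdiv) (norm_mollify_le (φ n) hM) hZn
    refine ((hDn.const_mul 2).add (hD.const_mul 2)).mono'
      (continuous_frobeniusNormSq_comp ((hTnc n).sub hTc)).aestronglyMeasurable
      (ae_of_all _ fun x => ?_)
    rw [Real.norm_of_nonneg (frobeniusNormSq_nonneg _)]
    exact frobeniusNormSq_sub_le _ _
  have hb0 : Tendsto b atTop (𝓝 0) := by
    have h1 := HasWeakGradient.tendsto_lintegral_frobenius_fderiv_convolution_sub hG hG2 hφ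
    have h2 := (ENNReal.tendsto_toReal ENNReal.zero_ne_top).comp h1
    simp only [ENNReal.toReal_zero] at h2
    refine h2.congr fun n => ?_
    simp only [Function.comp_apply]
    rw [hb, ← ofReal_integral_eq_lintegral_ofReal (hbint n)
      (ae_of_all _ fun x => frobeniusNormSq_nonneg _), ENNReal.toReal_ofReal
      (integral_nonneg fun x => frobeniusNormSq_nonneg _)]
  -- (3) the integrand difference is dominated by three Cauchy–Schwarz products
  set G : EuclideanSpace ℝ (Fin 3) → ℝ := fun x => ⟪om x, T x (om x)⟫ with hGdef
  set Gn : ℕ → EuclideanSpace ℝ (Fin 3) → ℝ := fun n x =>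
    ⟪curl (U n) x, fderiv ℝ (U n) x (curl (U n) x)⟫ with hGndef
  have hbound : ∀ n, Integrable (fun x => Gn n x - G x) ∧
      ∫ x, |Gn n x - G x| ≤ K * (Real.sqrt (a n) + Real.sqrt (b n) + Real.sqrt (a n)) := by
    intro n
    -- the three products
    obtain ⟨i1, e1⟩ := integrable_sq_norm_mul_norm (hTnc n) (homnc n) (hTn4 n).1 (homn4 n).1
    obtain ⟨i2, e2⟩ := integrable_sq_norm_mul_norm homc (homnc n) hom4 (homn4 n).1
    obtain ⟨i3, e3⟩ := integrable_sq_norm_mul_norm homc hTc hom4 hT4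
    -- the `L²` factors
    have hopint : Integrable fun x => ‖fderiv ℝ (U n) x - T x‖ ^ 2 := by
      refine (hbint n).mono' (((hTnc n).sub hTc).norm.pow 2).aestronglyMeasurable
        (ae_of_all _ fun x => ?_)
      rw [Real.norm_of_nonneg (sq_nonneg _)]
      exact sq_opNorm_le_frobeniusNormSq _
    have hople : ∫ x, ‖fderiv ℝ (U n) x - T x‖ ^ 2 ≤ b n :=
      integral_mono hopint (hbint n) fun x => sq_opNorm_le_frobeniusNormSq _
    have hcA : Continuous fun x => ‖curl (U n) x - om x‖ := ((homnc n).sub homc).norm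
    have hcB : Continuous fun x => ‖fderiv ℝ (U n) x - T x‖ := ((hTnc n).sub hTc).norm
    have hc1 : Continuous fun x => ‖fderiv ℝ (U n) x‖ * ‖curl (U n) x‖ :=
      (hTnc n).norm.mul (homnc n).norm
    have hc2 : Continuous fun x => ‖om x‖ * ‖curl (U n) x‖ := homc.norm.mul (homnc n).norm
    have hc3 : Continuous fun x => ‖om x‖ * ‖T x‖ := homc.norm.mul hTc.norm
    obtain ⟨j1, c1⟩ := integral_mul_le_sqrt_mul_sqrt (f := fun x => ‖curl (U n) x - om x‖)
      (g := fun x => ‖fderiv ℝ (U n) x‖ * ‖curl (U n) x‖) hcA hc1 (fun x => norm_nonneg _)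
      (fun x => mul_nonneg (norm_nonneg _) (norm_nonneg _)) (haint n) i1
    obtain ⟨j2, c2⟩ := integral_mul_le_sqrt_mul_sqrt (f := fun x => ‖fderiv ℝ (U n) x - T x‖)
      (g := fun x => ‖om x‖ * ‖curl (U n) x‖) hcB hc2 (fun x => norm_nonneg _)
      (fun x => mul_nonneg (norm_nonneg _) (norm_nonneg _)) hopint i2
    obtain ⟨j3, c3⟩ := integral_mul_le_sqrt_mul_sqrt (f := fun x => ‖curl (U n) x - om x‖)
      (g := fun x => ‖om x‖ * ‖T x‖) hcA hc3 (fun x => norm_nonneg _)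
      (fun x => mul_nonneg (norm_nonneg _) (norm_nonneg _)) (haint n) i3
    -- the majorant
    set m : EuclideanSpace ℝ (Fin 3) → ℝ := fun x =>
      ‖curl (U n) x - om x‖ * (‖fderiv ℝ (U n) x‖ * ‖curl (U n) x‖) +
        ‖fderiv ℝ (U n) x - T x‖ * (‖om x‖ * ‖curl (U n) x‖) +
        ‖curl (U n) x - om x‖ * (‖om x‖ * ‖T x‖) with hm
    have hmi : Integrable m := (j1.add j2).add j3
    have hpt : ∀ x, |Gn n x - G x| ≤ m x := fun x =>
      abs_inner_apply_sub_le (om x) (curl (U n) x) (T x) (fderiv ℝ (U n) x)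
    have hGc : Continuous fun x => Gn n x - G x := by
      refine Continuous.sub ?_ ?_
      · exact Continuous.inner (homnc n) ((hTnc n).clm_apply (homnc n))
      · exact Continuous.inner homc (hTc.clm_apply homc)
    have hdi : Integrable fun x => Gn n x - G x := by
      refine hmi.mono' hGc.aestronglyMeasurable (ae_of_all _ fun x => ?_)
      rw [Real.norm_eq_abs]
      exact hpt x
    refine ⟨hdi, ?_⟩
    -- bounds on the three square roots of products
    have hs1 : Real.sqrt (∫ x, (‖fderiv ℝ (U n) x‖ * ‖curl (U n) x‖) ^ 2) ≤
        Real.sqrt ((T4 + W4) / 2) :=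
      Real.sqrt_le_sqrt (e1.trans (by gcongr; exacts [(hTn4 n).2, (homn4 n).2]))
    have hs2 : Real.sqrt (∫ x, (‖om x‖ * ‖curl (U n) x‖) ^ 2) ≤ Real.sqrt ((W4 + W4) / 2) :=
      Real.sqrt_le_sqrt (e2.trans (by gcongr; exact (homn4 n).2))
    have hs3 : Real.sqrt (∫ x, (‖om x‖ * ‖T x‖) ^ 2) ≤ Real.sqrt ((W4 + T4) / 2) :=
      Real.sqrt_le_sqrt e3
    have hsb : Real.sqrt (∫ x, ‖fderiv ℝ (U n) x - T x‖ ^ 2) ≤ Real.sqrt (b n) :=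
      Real.sqrt_le_sqrt hople
    have hA0 : 0 ≤ Real.sqrt (a n) := Real.sqrt_nonneg _
    have hB0 : 0 ≤ Real.sqrt (b n) := Real.sqrt_nonneg _
    have hmsplit : ∫ x, m x =
        (∫ x, ‖curl (U n) x - om x‖ * (‖fderiv ℝ (U n) x‖ * ‖curl (U n) x‖)) +
          (∫ x, ‖fderiv ℝ (U n) x - T x‖ * (‖om x‖ * ‖curl (U n) x‖)) +
          ∫ x, ‖curl (U n) x - om x‖ * (‖om x‖ * ‖T x‖) := by
      show (∫ x, (‖curl (U n) x - om x‖ * (‖fderiv ℝ (U n) x‖ * ‖curl (U n) x‖) +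
          ‖fderiv ℝ (U n) x - T x‖ * (‖om x‖ * ‖curl (U n) x‖) +
          ‖curl (U n) x - om x‖ * (‖om x‖ * ‖T x‖))) = _
      have j12 : Integrable fun x => ‖curl (U n) x - om x‖ * (‖fderiv ℝ (U n) x‖ * ‖curl (U n) x‖) +
          ‖fderiv ℝ (U n) x - T x‖ * (‖om x‖ * ‖curl (U n) x‖) := j1.add j2
      rw [integral_add j12 j3, integral_add j1 j2]
    calc ∫ x, |Gn n x - G x| ≤ ∫ x, m x := integral_mono hdi.abs hmi hpt
      _ = (∫ x, ‖curl (U n) x - om x‖ * (‖fderiv ℝ (U n) x‖ * ‖curl (U n) x‖)) +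
            (∫ x, ‖fderiv ℝ (U n) x - T x‖ * (‖om x‖ * ‖curl (U n) x‖)) +
            ∫ x, ‖curl (U n) x - om x‖ * (‖om x‖ * ‖T x‖) := hmsplit
      _ ≤ Real.sqrt (a n) * Real.sqrt ((T4 + W4) / 2) +
            Real.sqrt (b n) * Real.sqrt ((W4 + W4) / 2) +
            Real.sqrt (a n) * Real.sqrt ((W4 + T4) / 2) := by
          refine add_le_add (add_le_add ?_ ?_) ?_
          · exact c1.trans (mul_le_mul_of_nonneg_left hs1 hA0)
          · exact c2.trans (mul_le_mul hsb hs2 (Real.sqrt_nonneg _) hB0)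
          · exact c3.trans (mul_le_mul_of_nonneg_left hs3 hA0)
      _ ≤ K * (Real.sqrt (a n) + Real.sqrt (b n) + Real.sqrt (a n)) := by
          rw [hK]
          have h1 : 0 ≤ Real.sqrt ((T4 + W4) / 2) := Real.sqrt_nonneg _
          have h2 : 0 ≤ Real.sqrt ((W4 + W4) / 2) := Real.sqrt_nonneg _
          have h3 : 0 ≤ Real.sqrt ((W4 + T4) / 2) := Real.sqrt_nonneg _
          nlinarith [mul_nonneg hA0 h2, mul_nonneg hA0 h3, mul_nonneg hB0 h1, mul_nonneg hB0 h3,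
            mul_nonneg hA0 h1, mul_nonneg hB0 h2]
  -- (4) conclude
  have herr : Tendsto (fun n => K * (Real.sqrt (a n) + Real.sqrt (b n) + Real.sqrt (a n))) atTop
      (𝓝 0) := by
    have hsa : Tendsto (fun n => Real.sqrt (a n)) atTop (𝓝 0) := by
      have := (Real.continuous_sqrt.tendsto 0).comp ha0
      simpa [Function.comp_def] using this
    have hsb : Tendsto (fun n => Real.sqrt (b n)) atTop (𝓝 0) := by
      have := (Real.continuous_sqrt.tendsto 0).comp hb0
      simpa [Function.comp_def] using this
    have := ((hsa.add hsb).add hsa).const_mul K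
    simpa using this
  rw [tendsto_iff_norm_sub_tendsto_zero]
  refine squeeze_zero (fun n => norm_nonneg _) (fun n => ?_) herr
  obtain ⟨hdi, hle⟩ := hbound n
  have hGi : Integrable G := hJ
  have hGni : Integrable (Gn n) := by
    have h := hdi.add hGi
    refine h.congr (ae_of_all _ fun x => ?_)
    show Gn n x - G x + G x = Gn n x
    ring
  rw [Real.norm_eq_abs]
  calc |(∫ x, Gn n x) - ∫ x, G x| = |∫ x, (Gn n x - G x)| := by rw [integral_sub hGni hGi]
    _ ≤ ∫ x, |Gn n x - G x| := abs_integral_le_integral_abs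
    _ ≤ K * (Real.sqrt (a n) + Real.sqrt (b n) + Real.sqrt (a n)) := hle

/-- ★ **The sharp depletion inequality on the WHOLE registered class.** For `u ∈ C²(ℝ³; ℝ³)`
divergence free with `‖u‖ ≤ M`, `‖curl u‖² ∈ L¹`, `|∇ curl u|²_F ∈ L¹` and `⟪ω, Du ω⟫ ∈ L¹` (the exact
binders of `StretchingDepletion`):
`|∫⟪curl u, Du (curl u)⟫| ≤ ((2+√3)/9) · M · √(∫‖curl u‖²) · √(∫|∇ curl u|²_F)`. The bound holds for
every mollification `uₙ` with the right-hand side of `u` (P5), and the left-hand sides converge.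
[folklore] -/
theorem abs_integral_stretching_le_sharp_of_registered (hu : ContDiff ℝ 2 u)
    (hdiv : VectorCalculus.IsDivFree u) {M : ℝ} (hM : ∀ x, ‖u x‖ ≤ M)
    (hZ : Integrable fun x => ‖curl u x‖ ^ 2)
    (hP : Integrable fun x => frobeniusNormSq (fderiv ℝ (curl u) x))
    (hJ : Integrable fun x => ⟪curl u x, fderiv ℝ u x (curl u x)⟫) :
    |∫ x, ⟪curl u x, fderiv ℝ u x (curl u x)⟫| ≤
      (2 + Real.sqrt 3) / 9 * M * Real.sqrt (∫ x, ‖curl u x‖ ^ 2) *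
        Real.sqrt (∫ x, frobeniusNormSq (fderiv ℝ (curl u) x)) := by
  obtain ⟨φ, hφ, -⟩ := exists_contDiffBump_seq (E := EuclideanSpace ℝ (Fin 3))
  have hlim := tendsto_integral_stretching_mollify hu hdiv hM hZ hP hJ hφ
  have hbd := fun n => abs_integral_stretching_mollify_le (φ n) hu hdiv hM hZ hP
  exact le_of_tendsto' hlim.abs hbd

end Summit.NavierStokesRegularity.NavierStokesRegularity.Theorems.DepletionLadder.BoundedStretchingLimit

end
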